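import Summits.QuantumFields.YangMills.Theorems.BalabanUVNodesN20KeyedRelWeightValueStrata

/-!
# BalabanUVNodes ∕ N20 (NE7b) — THE N20 FACE AT dag-n20-d's KEY-READING EDITION IN THE EXPONENTIAL-MOMENT (GENERATING-FUNCTION) CURRENCY: a threshold bad reading
# `n K ≤ φ K ·` on a key statistic is priced by ONE number per step — the exponential moment `Σ_u z^{φ K u}·weight(u) ≤ M_K · Σ_u weight(u)` of the statistic under each run's
# keyed class weights (`z ≥ 1`) — through MARKOV's inequality: `W K ≤ M_K ∕ z^{n K}`; the currency is EQUIVALENT to gen 4's per-value geometric letter (both directions typed)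

Cell `pub-ymgap` (HUMAN RULING D-0062 Track A; width push D-0149, director-ym №197), width seat `pub-ymgap-dag-n20-w2` (gen 5) on node N20 = NE7b; key item K3⁸
`SpineGivenEndpointR13SepCoPHV` = stmt-QuantumFields-27366 (KEY MAP v2; K3⁷ stmt-QuantumFields-20544 aside); `--kind proof --supports … --as helper`; COUNT-NEUTRAL; LOCATED.
[LF-I] = [Balaban1989LargeFieldI], [LF-II] = [Balaban1989LargeFieldII].

WHY.  Gen 4's SIZE currency (`…N20KeyedRelWeightValueStrata`, p620106) prices a threshold reading at n20-d's coarse carriers `crOfRecord₁₃KAt K₀ kr bd sh` by a PER-VALUE letter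
«the value fibre `{φ K · = m}` carries at most the fraction `V·q^m` of each run's keyed mass» (`W K ≤ V·q^{n K}∕(1−q)`).  The natural OUTPUT of a large-field ∕ Peierls estimate is
not a per-value bound but ONE exponential moment per step — «`Σ_u z^{φ K u}·weightAK … u ≤ M_K · Σ_u weightAK … u`» (the generating function of the statistic under the normalised
class-weight law, evaluated at `z ≥ 1`; the shape of dag-n20-d's by-value (JM) joint exponential PLAQUETTE moments `jointExpMoment_levels` p513300, there under the bare Wilson–Gibbs
state, and of [LF-II] (1.89)'s use: a large-field volume costs `e^{−p₀}` per cube, so `z := e^{p₀∕2}` has a bounded moment).  Markov's inequality turns it into the face directly,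
with NO `1∕(1−q)` loss, and the two currencies are the same up to constants:
* §1 FOLKLORE (a finite set `S`, a statistic `φ : ι → ℕ`, weights `f ≥ 0` on `S`, `1 ≤ z`): `sum_filter_threshold_le_genFun_div_pow` (MARKOV: `Σ_{n ≤ φ} f ≤ (Σ_S z^φ·f) ∕ z^n`) ·
  `sum_filter_eq_le_genFun_div_pow` (a value fibre: `Σ_{φ = m} f ≤ (Σ_S z^φ·f) ∕ z^m`) · `genFun_le_of_valueFractions` (CONVERSELY a per-value geometric letter `V·q^m·Σ_S f` with
  `q·z < 1` bounds the generating function by `V∕(1 − q z) · Σ_S f`) — the exponential-moment and the geometric-value-tail currencies are EQUIVALENT up to constants;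
* §2 AT THE COARSE CARRIERS (any dial `kr`, the bad reading reads as `n K ≤ φ K ·` on the class set): ★★ `W_crOfRecord₁₃KAt_thr_le_genFun` (`W K ≤ M_K ∕ z^{n K}`) · ★★
  `relWeightBound_crOfRecord₁₃KAt_thr_of_genFun` (THE DESIGN RULE in this currency: `M_K ∕ z^{n K} < 1` at every step and `Σ_K M_K ∕ z^{n K} < ∞`) · `…_of_genFun_linear` (constant
  moment bound `M`, `1 < z`, threshold floor `n₀` with `M < z^{n₀}`, linear growth `c·K ≤ n K`) · `valueFraction_of_genFun` (the moment letter IMPLIES gen 4's per-value letter with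
  `V := M_K`, `q := z⁻¹`, so every gen-4 socket applies too);
* §3 INSTANCE at dag-n20-d's NAMED component-forgiving dial `forgiveCompReading₁₃ K₀ c` with the FLOOR-VOLUME statistic (their `badKeyReadingOfFloorVolume₁₃` spelling, key-step
  convention): ★★ `relWeightBound_forgiveCompReading₁₃_floorVolume_of_genFun` — «the exponential moment of the forgiven key's large-field volume one level above the floor is `≤ M`
  under both runs' keyed class weights; threshold `≥ n₀ + c·K` sites» ⇒ the N20 face there.
WHAT IT SAYS (located, count-neutral): in the size currency the N20 face at a typed key asks for ONE exponential-moment letter per run and step (the multi-block large-deviation estimate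
in generating-function form), a base `z > 1` and a threshold growing linearly; the letter is NE7b's body at the coarse key — NAMED OPEN, NOT PRINTED for `d = 4`, NOT proved; at the
bare Wilson–Gibbs state dag-n20-d's multiscale Peierls law has this shape with LEVEL-DEPENDENT constants (the located wall (MSP) p517672), which this file does not touch.
Cited BY NAME, not re-typed: dag-n20-d `…SpineReadingOfRecord13CoPHK` (`crOfRecord₁₃KAt`, `classSetK₁₃`, `weightAK∕BK₁₃`, `badClassK₁₃`, `badClassK₁₃_subset`), `…CoPHKForgive`
(`forgiveCompReading₁₃`), `Node00/TwoRunSiteLargeField…` (`largeFieldVolume`), `…SpineCanonicalWeights` (`wInf`, …); gen 3 `…AtKeyReading` (`relWeightBound_crOfRecord₁₃KAt_iff`,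
`weightAK∕BK₁₃_nonneg_of_provisos`); gen 4 `…ValueStrata` (`badClassK₁₃_congr_on`, `badClassK₁₃_thr_eq_filter`, `summable_geomThreshold_of_linear`, `fst_eq_of_mem_classSetK₁₃`);
dag-n20-d `forgiveKeyCompSigma_fst_eq`.

HONEST FRAMING.  [folklore] finite-sum ∕ real-analysis bookkeeping BY NAME (Markov's inequality on a finite weighted sum); NO weight bounded, NO estimate proved; every moment ∕
per-value letter is a HYPOTHESIS (NE7b's body at the coarse key, NAMED OPEN); `z, M, n₀, c` are read from no record object; nothing of Bałaban's is asserted; NE7 ∕ NE7b ∕ NE7c NOT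
PRINTED for `d = 4`, NOT proved; the key-reading edition is NOT the registered v6 `PinnedAtLive` pin (identity dial); no `Provisos₁₃CoPH` inhabitant claimed (K0⁷ OPEN); N19 ∕ N20 ∕
N21 ∕ N27 NOT discharged; K3⁸ ∕ K3⁷ NOT closed; counts unmoved (typed 28∕28 · discharged 5∕27); no count claim.  One finite `𝕋⁴_{L^K}` programme at fixed `ε = L^{−K}`, Bałaban AS
PRINTED; the YM mass gap (Clay) is NOT proved by any of this — R4 closes the conditional finite-𝕋⁴ rung `BalabanLadder.UV` only; NOT ℝ⁴, NOT infinite volume, NOT OS.  No `def`, no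
`instance`, no `notation`, no `sorry`.  Sources (locators, bookkeeping only): [LF-I] (0.2) p.176, p.177 (i)–(ii); [LF-II] Thm 1 + (0.1) pp.355–356, (1.79)–(1.80) pp.383–384, (1.89)
p.387; [King1986] (3.10)–(3.11) p.656.
-/

noncomputable section

open scoped BigOperators

namespace Summit.QuantumFields.YangMills.BalabanUVNodes.N20KeyedRelWeightGenFun

open Literature.MathematicalPhysics.QuantumFieldTheory.Balaban1983to89 Literature.MathematicalPhysics.QuantumFieldTheory.Balaban1983to89.Node00
open T4Continuum
open T4WeightBudget (RelWeightBound)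
open YMDAG.UVSplit hiding SU
open Summit.QuantumFields.YangMills.BalabanUVNodes.SpineCanonicalWeights
open Summit.QuantumFields.YangMills.BalabanUVNodes.N20KeyedRelWeightAtKeyReading (weightAK₁₃_nonneg_of_provisos weightBK₁₃_nonneg_of_provisos relWeightBound_crOfRecord₁₃KAt_iff
  fst_eq_of_mem_classSetK₁₃)
open Summit.QuantumFields.YangMills.BalabanUVNodes.N20KeyedRelWeightAtForgivingKey (forgiveKeyCompSigma_fst_eq)
open Summit.QuantumFields.YangMills.BalabanUVNodes.N20KeyedRelWeightValueStrata (badClassK₁₃_congr_on badClassK₁₃_thr_eq_filter summable_geomThreshold_of_linear)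

variable {F : T4Family} {N : ℕ} [NeZero N]

/-! ## §1  Folklore: Markov's inequality on a finite weighted sum; the exponential-moment and geometric-value-tail currencies are equivalent -/

section Markov

variable {ι : Type*} (S : Finset ι) (φ : ι → ℕ) (f : ι → ℝ)

/-- **MARKOV ON A FINITE WEIGHTED SUM**: non-negative weights `f` on `S`, a statistic `φ : ι → ℕ`, a base `1 ≤ z` ⇒ the mass of the threshold class `{n ≤ φ}` is at most the
generating function over `z^n`: `Σ_{u ∈ S, n ≤ φ u} f u ≤ (Σ_{u ∈ S} z^{φ u}·f u) ∕ z^n`. [cite: Balaban1989LargeFieldII, (1.89) p.387 (bookkeeping)] -/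
theorem sum_filter_threshold_le_genFun_div_pow (hf : ∀ u ∈ S, 0 ≤ f u) {z : ℝ} (hz : 1 ≤ z) (n : ℕ) :
    ∑ u ∈ S.filter (fun u => n ≤ φ u), f u ≤ (∑ u ∈ S, z ^ φ u * f u) / z ^ n := by
  have hz0 : 0 < z := zero_lt_one.trans_le hz
  rw [le_div_iff₀ (pow_pos hz0 n), Finset.sum_mul]
  calc ∑ u ∈ S.filter (fun u => n ≤ φ u), f u * z ^ n
      ≤ ∑ u ∈ S.filter (fun u => n ≤ φ u), z ^ φ u * f u := Finset.sum_le_sum fun u hu => by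
          rw [mul_comm]
          exact mul_le_mul_of_nonneg_right (pow_le_pow_right₀ hz (Finset.mem_filter.1 hu).2) (hf u (Finset.mem_filter.1 hu).1)
    _ ≤ ∑ u ∈ S, z ^ φ u * f u :=
          Finset.sum_le_sum_of_subset_of_nonneg (Finset.filter_subset _ S) fun u hu _ => mul_nonneg (pow_nonneg hz0.le _) (hf u hu)

/-- **A VALUE FIBRE COSTS AT MOST THE GENERATING FUNCTION OVER `z^m`**: `Σ_{u ∈ S, φ u = m} f u ≤ (Σ_{u ∈ S} z^{φ u}·f u) ∕ z^m` (`f ≥ 0` on `S`, `1 ≤ z`).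
[cite: Balaban1989LargeFieldII, (1.89) p.387 (bookkeeping)] -/
theorem sum_filter_eq_le_genFun_div_pow (hf : ∀ u ∈ S, 0 ≤ f u) {z : ℝ} (hz : 1 ≤ z) (m : ℕ) :
    ∑ u ∈ S.filter (fun u => φ u = m), f u ≤ (∑ u ∈ S, z ^ φ u * f u) / z ^ m :=
  (Finset.sum_le_sum_of_subset_of_nonneg (fun u hu => by
      rw [Finset.mem_filter] at hu ⊢
      exact ⟨hu.1, hu.2.ge⟩) fun u hu _ => hf u (Finset.mem_filter.1 hu).1).trans
    (sum_filter_threshold_le_genFun_div_pow S φ f hf hz m)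

/-- **CONVERSELY, A PER-VALUE GEOMETRIC LETTER BOUNDS THE GENERATING FUNCTION**: if every value fibre `{φ = m}` carries at most `V·q^m·Σ_S f` (`0 ≤ q`, `0 ≤ V`, `f ≥ 0` on `S`) and
`0 ≤ z` with `q·z < 1`, then `Σ_S z^φ·f ≤ V∕(1 − q z) · Σ_S f` — the exponential-moment currency and gen 4's geometric value-tail currency are EQUIVALENT up to constants.
[cite: Balaban1989LargeFieldII, (1.79)–(1.80) pp.383–384 (bookkeeping)] -/
theorem genFun_le_of_valueFractions (hf : ∀ u ∈ S, 0 ≤ f u) {q V z : ℝ} (hq : 0 ≤ q) (hV : 0 ≤ V) (hz : 0 ≤ z) (hqz : q * z < 1)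
    (hval : ∀ m : ℕ, ∑ u ∈ S.filter (fun u => φ u = m), f u ≤ V * q ^ m * ∑ u ∈ S, f u) :
    ∑ u ∈ S, z ^ φ u * f u ≤ V / (1 - q * z) * ∑ u ∈ S, f u := by
  classical
  have hS0 : 0 ≤ ∑ u ∈ S, f u := Finset.sum_nonneg hf
  -- fibrewise over the attained values
  rw [← Finset.sum_fiberwise_of_maps_to (g := φ) (t := S.image φ) (fun u hu => Finset.mem_image_of_mem φ hu)]
  have hfib : ∀ m ∈ S.image φ, ∑ u ∈ S.filter (fun u => φ u = m), z ^ φ u * f u ≤ (q * z) ^ m * (V * ∑ u ∈ S, f u) := by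
    intro m _
    calc ∑ u ∈ S.filter (fun u => φ u = m), z ^ φ u * f u = z ^ m * ∑ u ∈ S.filter (fun u => φ u = m), f u := by
            rw [Finset.mul_sum]
            exact Finset.sum_congr rfl fun u hu => by rw [(Finset.mem_filter.1 hu).2]
      _ ≤ z ^ m * (V * q ^ m * ∑ u ∈ S, f u) := mul_le_mul_of_nonneg_left (hval m) (pow_nonneg hz m)
      _ = (q * z) ^ m * (V * ∑ u ∈ S, f u) := by rw [mul_pow]; ring
  refine (Finset.sum_le_sum hfib).trans ?_
  rw [← Finset.sum_mul]
  have hgeom : ∑ m ∈ S.image φ, (q * z) ^ m ≤ 1 / (1 - q * z) := by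
    have hqz0 : 0 ≤ q * z := mul_nonneg hq hz
    calc ∑ m ∈ S.image φ, (q * z) ^ m ≤ ∑' m : ℕ, (q * z) ^ m :=
          (summable_geometric_of_lt_one hqz0 hqz).sum_le_tsum _ fun m _ => pow_nonneg hqz0 m
      _ = 1 / (1 - q * z) := by rw [tsum_geometric_of_lt_one hqz0 hqz, one_div]
  calc (∑ m ∈ S.image φ, (q * z) ^ m) * (V * ∑ u ∈ S, f u) ≤ 1 / (1 - q * z) * (V * ∑ u ∈ S, f u) :=
        mul_le_mul_of_nonneg_right hgeom (mul_nonneg hV hS0)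
    _ = V / (1 - q * z) * ∑ u ∈ S, f u := by ring

end Markov

/-! ## §2  The sockets at the reading `crOfRecord₁₃KAt K₀ kr bd sh` whose bad reading READS AS a threshold on a key statistic: one exponential moment per run and step -/

section Sockets

variable (θ : Stage13HParams F N) (hP : θ.Provisos₁₃CoPH F N) (K₀ : ℕ) (g₀ : ℕ → ℝ) (os : List (ULoop F)) (krR : KeyReading₁₃ N K₀) (bdR : BadKeyReading₁₃ N K₀)
  (sh : ShellSplit₁₃CoPH N K₀) (φ : ℕ → (Σ K, SiteSeqKey F (K₀ + K)) → ℕ) (n : ℕ → ℕ)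
  (hbd : ∀ K, ∀ u ∈ classSetK₁₃ θ K₀ g₀ (krR F θ hP g₀ os) K, (bdR F θ hP g₀ os K u ↔ n K ≤ φ K u))
include hbd

/-- **★★ THE READING's FRACTION UNDER AN EXPONENTIAL-MOMENT LETTER** (any dial; the bad reading reads as `n K ≤ φ K ·` at the tuple): if at step `K`, for every `|t| ≤ 1`, the
`z`-exponential moment of the statistic under each run's keyed class weights is at most `M K` times that run's keyed mass (`1 ≤ z`, `0 ≤ M K`), then
`(crOfRecord₁₃KAt K₀ kr bd sh …).W K ≤ M K ∕ z^{n K}` — Markov's inequality; `M K ∕ z^{n K}` is an ADMISSIBLE weight.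
[cite: Balaban1989LargeFieldII, (1.80) p.384, (1.89) p.387; King1986, (3.10)–(3.11) p.656 (bookkeeping)] -/
theorem W_crOfRecord₁₃KAt_thr_le_genFun {z : ℝ} (hz : 1 ≤ z) {M : ℕ → ℝ} (K : ℕ) (hM : 0 ≤ M K)
    (hA : ∀ t : ℝ, |t| ≤ 1 →
      ∑ u ∈ classSetK₁₃ θ K₀ g₀ (krR F θ hP g₀ os) K, z ^ φ K u * weightAK₁₃ θ hP K₀ g₀ os (krR F θ hP g₀ os) K t u ≤
        M K * ∑ u ∈ classSetK₁₃ θ K₀ g₀ (krR F θ hP g₀ os) K, weightAK₁₃ θ hP K₀ g₀ os (krR F θ hP g₀ os) K t u)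
    (hB : ∀ t : ℝ, |t| ≤ 1 →
      ∑ u ∈ classSetK₁₃ θ K₀ g₀ (krR F θ hP g₀ os) K, z ^ φ K u * weightBK₁₃ θ hP K₀ g₀ os (krR F θ hP g₀ os) K t u ≤
        M K * ∑ u ∈ classSetK₁₃ θ K₀ g₀ (krR F θ hP g₀ os) K, weightBK₁₃ θ hP K₀ g₀ os (krR F θ hP g₀ os) K t u) :
    (crOfRecord₁₃KAt K₀ krR bdR sh F θ hP g₀ os).W K ≤ M K / z ^ n K := by
  have hz0 : 0 ≤ z ^ n K := pow_nonneg (zero_le_one.trans hz) _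
  have hcl : ∀ t : ℝ, badClassK₁₃ θ K₀ g₀ (krR F θ hP g₀ os) (bdR F θ hP g₀ os) K t =
      (classSetK₁₃ θ K₀ g₀ (krR F θ hP g₀ os) K).filter (fun u => n K ≤ φ K u) := fun t => by
    rw [badClassK₁₃_congr_on θ K₀ g₀ (krR F θ hP g₀ os) (bd' := fun K u => n K ≤ φ K u) (hbd K) t, badClassK₁₃_thr_eq_filter]
  refine wInf_le_of_mem ⟨div_nonneg hM hz0, fun t ht => ⟨?_, ?_⟩⟩
  · show ∑ u ∈ badClassK₁₃ θ K₀ g₀ (krR F θ hP g₀ os) (bdR F θ hP g₀ os) K t, weightAK₁₃ θ hP K₀ g₀ os (krR F θ hP g₀ os) K t u ≤ _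
    rw [hcl t]
    calc _ ≤ (∑ u ∈ classSetK₁₃ θ K₀ g₀ (krR F θ hP g₀ os) K, z ^ φ K u * weightAK₁₃ θ hP K₀ g₀ os (krR F θ hP g₀ os) K t u) / z ^ n K :=
          sum_filter_threshold_le_genFun_div_pow _ (φ K) _ (fun u _ => weightAK₁₃_nonneg_of_provisos θ hP K₀ g₀ os (krR F θ hP g₀ os) K t u) hz (n K)
      _ ≤ (M K * ∑ u ∈ classSetK₁₃ θ K₀ g₀ (krR F θ hP g₀ os) K, weightAK₁₃ θ hP K₀ g₀ os (krR F θ hP g₀ os) K t u) / z ^ n K :=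
          div_le_div_of_nonneg_right (hA t ht) hz0
      _ = M K / z ^ n K * ∑ u ∈ classSetK₁₃ θ K₀ g₀ (krR F θ hP g₀ os) K, weightAK₁₃ θ hP K₀ g₀ os (krR F θ hP g₀ os) K t u := by ring
  · show ∑ u ∈ badClassK₁₃ θ K₀ g₀ (krR F θ hP g₀ os) (bdR F θ hP g₀ os) K t, weightBK₁₃ θ hP K₀ g₀ os (krR F θ hP g₀ os) K t u ≤ _
    rw [hcl t]
    calc _ ≤ (∑ u ∈ classSetK₁₃ θ K₀ g₀ (krR F θ hP g₀ os) K, z ^ φ K u * weightBK₁₃ θ hP K₀ g₀ os (krR F θ hP g₀ os) K t u) / z ^ n K :=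
          sum_filter_threshold_le_genFun_div_pow _ (φ K) _ (fun u _ => weightBK₁₃_nonneg_of_provisos θ hP K₀ g₀ os (krR F θ hP g₀ os) K t u) hz (n K)
      _ ≤ (M K * ∑ u ∈ classSetK₁₃ θ K₀ g₀ (krR F θ hP g₀ os) K, weightBK₁₃ θ hP K₀ g₀ os (krR F θ hP g₀ os) K t u) / z ^ n K :=
          div_le_div_of_nonneg_right (hB t ht) hz0
      _ = M K / z ^ n K * ∑ u ∈ classSetK₁₃ θ K₀ g₀ (krR F θ hP g₀ os) K, weightBK₁₃ θ hP K₀ g₀ os (krR F θ hP g₀ os) K t u := by ring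

/-- **★★ N20 AT THE READING FROM ONE EXPONENTIAL MOMENT PER RUN AND STEP — THE DESIGN RULE IN THE GENERATING-FUNCTION CURRENCY**: base `1 ≤ z`, moment bounds `0 ≤ M K` at every
step (both runs, every `|t| ≤ 1`), `M K ∕ z^{n K} < 1` at every step and `Σ_K M K ∕ z^{n K} < ∞` ⇒ `RelWeightBound` AT `crOfRecord₁₃KAt K₀ kr bd sh F θ hP g₀ os` with its canonical `W`
(gen 3's `relWeightBound_crOfRecord₁₃KAt_iff`).  The moment letter is NE7b's body at the coarse key — NAMED OPEN.
[cite: Balaban1989LargeFieldII, Thm 1 + (0.1) pp.355–356, (1.80) p.384, (1.89) p.387; King1986, (3.10)–(3.11) p.656 (bookkeeping)] -/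
theorem relWeightBound_crOfRecord₁₃KAt_thr_of_genFun {z : ℝ} (hz : 1 ≤ z) {M : ℕ → ℝ} (hM : ∀ K, 0 ≤ M K)
    (hA : ∀ (K : ℕ) (t : ℝ), |t| ≤ 1 →
      ∑ u ∈ classSetK₁₃ θ K₀ g₀ (krR F θ hP g₀ os) K, z ^ φ K u * weightAK₁₃ θ hP K₀ g₀ os (krR F θ hP g₀ os) K t u ≤
        M K * ∑ u ∈ classSetK₁₃ θ K₀ g₀ (krR F θ hP g₀ os) K, weightAK₁₃ θ hP K₀ g₀ os (krR F θ hP g₀ os) K t u)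
    (hB : ∀ (K : ℕ) (t : ℝ), |t| ≤ 1 →
      ∑ u ∈ classSetK₁₃ θ K₀ g₀ (krR F θ hP g₀ os) K, z ^ φ K u * weightBK₁₃ θ hP K₀ g₀ os (krR F θ hP g₀ os) K t u ≤
        M K * ∑ u ∈ classSetK₁₃ θ K₀ g₀ (krR F θ hP g₀ os) K, weightBK₁₃ θ hP K₀ g₀ os (krR F θ hP g₀ os) K t u)
    (hlt : ∀ K, M K / z ^ n K < 1) (hsum : Summable fun K => M K / z ^ n K) :
    RelWeightBound (crOfRecord₁₃KAt K₀ krR bdR sh F θ hP g₀ os).l₀ (crOfRecord₁₃KAt K₀ krR bdR sh F θ hP g₀ os).T (crOfRecord₁₃KAt K₀ krR bdR sh F θ hP g₀ os).A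
      (crOfRecord₁₃KAt K₀ krR bdR sh F θ hP g₀ os).B (crOfRecord₁₃KAt K₀ krR bdR sh F θ hP g₀ os).Bad (crOfRecord₁₃KAt K₀ krR bdR sh F θ hP g₀ os).W := by
  have hle : ∀ K, (crOfRecord₁₃KAt K₀ krR bdR sh F θ hP g₀ os).W K ≤ M K / z ^ n K := fun K =>
    W_crOfRecord₁₃KAt_thr_le_genFun θ hP K₀ g₀ os krR bdR sh φ n hbd hz K (hM K) (hA K) (hB K)
  exact (relWeightBound_crOfRecord₁₃KAt_iff θ hP K₀ g₀ os krR bdR sh).2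
    ⟨fun K => (hle K).trans_lt (hlt K), Summable.of_nonneg_of_le (fun K => wInf_nonneg K) hle hsum⟩

/-- **… WITH A CONSTANT MOMENT BOUND, A THRESHOLD FLOOR AND LINEAR GROWTH**: `1 < z`, `0 ≤ M`, `M < z^{n₀}`, `n₀ ≤ n K` and `c·K ≤ n K` (`c > 0`) supply both numeric conditions
(`M ∕ z^{n K} ≤ M ∕ z^{n₀} < 1`; summability by gen 4's `summable_geomThreshold_of_linear` at `q := z⁻¹`). [cite: Balaban1989LargeFieldII, Thm 1 + (0.1) pp.355–356, (1.89) p.387; King1986, (3.10)–(3.11) p.656 (bookkeeping)] -/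
theorem relWeightBound_crOfRecord₁₃KAt_thr_of_genFun_linear {z M c : ℝ} {n₀ : ℕ} (hz : 1 < z) (hM : 0 ≤ M) (hc : 0 < c) (hthr : M < z ^ n₀)
    (hfloor : ∀ K, n₀ ≤ n K) (hlin : ∀ K : ℕ, c * K ≤ (n K : ℝ))
    (hA : ∀ (K : ℕ) (t : ℝ), |t| ≤ 1 →
      ∑ u ∈ classSetK₁₃ θ K₀ g₀ (krR F θ hP g₀ os) K, z ^ φ K u * weightAK₁₃ θ hP K₀ g₀ os (krR F θ hP g₀ os) K t u ≤
        M * ∑ u ∈ classSetK₁₃ θ K₀ g₀ (krR F θ hP g₀ os) K, weightAK₁₃ θ hP K₀ g₀ os (krR F θ hP g₀ os) K t u)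
    (hB : ∀ (K : ℕ) (t : ℝ), |t| ≤ 1 →
      ∑ u ∈ classSetK₁₃ θ K₀ g₀ (krR F θ hP g₀ os) K, z ^ φ K u * weightBK₁₃ θ hP K₀ g₀ os (krR F θ hP g₀ os) K t u ≤
        M * ∑ u ∈ classSetK₁₃ θ K₀ g₀ (krR F θ hP g₀ os) K, weightBK₁₃ θ hP K₀ g₀ os (krR F θ hP g₀ os) K t u) :
    RelWeightBound (crOfRecord₁₃KAt K₀ krR bdR sh F θ hP g₀ os).l₀ (crOfRecord₁₃KAt K₀ krR bdR sh F θ hP g₀ os).T (crOfRecord₁₃KAt K₀ krR bdR sh F θ hP g₀ os).A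
      (crOfRecord₁₃KAt K₀ krR bdR sh F θ hP g₀ os).B (crOfRecord₁₃KAt K₀ krR bdR sh F θ hP g₀ os).Bad (crOfRecord₁₃KAt K₀ krR bdR sh F θ hP g₀ os).W := by
  have hz0 : 0 < z := zero_lt_one.trans hz
  have hpow : ∀ K, M / z ^ n K = M * z⁻¹ ^ n K := fun K => by rw [inv_pow, div_eq_mul_inv]
  refine relWeightBound_crOfRecord₁₃KAt_thr_of_genFun θ hP K₀ g₀ os krR bdR sh φ n hbd hz.le (fun _ => hM) hA hB (fun K => ?_) ?_
  · have h1 : M / z ^ n K ≤ M / z ^ n₀ := div_le_div_of_nonneg_left hM (pow_pos hz0 _) (pow_le_pow_right₀ hz.le (hfloor K))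
    exact h1.trans_lt ((div_lt_one (pow_pos hz0 _)).2 hthr)
  · simp only [hpow]
    exact summable_geomThreshold_of_linear (inv_pos.2 hz0) (inv_lt_one_of_one_lt₀ hz) hM hc hlin

omit hbd in
/-- **THE MOMENT LETTER IMPLIES GEN 4's PER-VALUE GEOMETRIC LETTER** (`V := M K`, `q := z⁻¹`), run A: under the `z`-exponential-moment bound at step `K`, every value fibre
`{φ K · = m}` of the coarse class set carries at most `M K·(z⁻¹)^m` of run A's keyed mass — so every socket of `…ValueStrata` ∕ `…ValuePredicate` ∕ `…UnionReading` applies to a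
moment letter as well. [cite: Balaban1989LargeFieldII, (1.79)–(1.80) pp.383–384, (1.89) p.387 (bookkeeping)] -/
theorem valueFraction_of_genFun {z : ℝ} (hz : 1 ≤ z) {M : ℕ → ℝ} (K : ℕ) {t : ℝ}
    (hA : ∑ u ∈ classSetK₁₃ θ K₀ g₀ (krR F θ hP g₀ os) K, z ^ φ K u * weightAK₁₃ θ hP K₀ g₀ os (krR F θ hP g₀ os) K t u ≤
        M K * ∑ u ∈ classSetK₁₃ θ K₀ g₀ (krR F θ hP g₀ os) K, weightAK₁₃ θ hP K₀ g₀ os (krR F θ hP g₀ os) K t u) (m : ℕ) :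
    ∑ u ∈ (classSetK₁₃ θ K₀ g₀ (krR F θ hP g₀ os) K).filter (fun u => φ K u = m), weightAK₁₃ θ hP K₀ g₀ os (krR F θ hP g₀ os) K t u ≤
      M K * z⁻¹ ^ m * ∑ u ∈ classSetK₁₃ θ K₀ g₀ (krR F θ hP g₀ os) K, weightAK₁₃ θ hP K₀ g₀ os (krR F θ hP g₀ os) K t u := by
  have hz0 : 0 ≤ z ^ m := pow_nonneg (zero_le_one.trans hz) _
  calc _ ≤ (∑ u ∈ classSetK₁₃ θ K₀ g₀ (krR F θ hP g₀ os) K, z ^ φ K u * weightAK₁₃ θ hP K₀ g₀ os (krR F θ hP g₀ os) K t u) / z ^ m :=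
        sum_filter_eq_le_genFun_div_pow _ (φ K) _ (fun u _ => weightAK₁₃_nonneg_of_provisos θ hP K₀ g₀ os (krR F θ hP g₀ os) K t u) hz m
    _ ≤ (M K * ∑ u ∈ classSetK₁₃ θ K₀ g₀ (krR F θ hP g₀ os) K, weightAK₁₃ θ hP K₀ g₀ os (krR F θ hP g₀ os) K t u) / z ^ m :=
        div_le_div_of_nonneg_right hA hz0
    _ = M K * z⁻¹ ^ m * ∑ u ∈ classSetK₁₃ θ K₀ g₀ (krR F θ hP g₀ os) K, weightAK₁₃ θ hP K₀ g₀ os (krR F θ hP g₀ os) K t u := by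
        rw [inv_pow]; ring

end Sockets

/-! ## §3  Instance at dag-n20-d's NAMED component-forgiving dial `forgiveCompReading₁₃ K₀ c` with the FLOOR-VOLUME statistic `largeFieldVolume (c · + 1)` -/

section FloorVolume

variable (θ : Stage13HParams F N) (hP : θ.Provisos₁₃CoPH F N) (K₀ : ℕ) (g₀ : ℕ → ℝ) (os : List (ULoop F)) (cR nR : FloorReading₁₃ N) (sh : ShellSplit₁₃CoPH N K₀)

/-- **★★ THE GENERATING-FUNCTION DESIGN RULE AT THE NAMED FORGIVING DIAL WITH THE FLOOR-VOLUME READING** «the large-field region one level above the floor of the FORGIVEN key has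
`≥ nR … K` finest sites» (dag-n20-d's key-step spelling `fun … _ x ↦ nR … x.1 ≤ largeFieldVolume (cR … x.1 + 1) x.2`, their `badKeyReadingOfFloorVolume₁₃` re-keys it by `rfl`): base
`1 < z`, ONE moment bound `M` — «`Σ_u z^{vol(u)}·weight(u) ≤ M·Σ_u weight(u)` for the floor volume `vol` under BOTH runs' keyed class weights, every step and `|t| ≤ 1`» —, a threshold
floor `n₀` with `M < z^{n₀}` and linear growth `c·K ≤ nR … K` ⇒ the N20 face AT `crOfRecord₁₃KAt K₀ (forgiveCompReading₁₃ K₀ cR) (floor-volume ≥ nR) sh F θ hP g₀ os`.  HYPOTHESIS = the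
multi-block large-deviation estimate at the window key in generating-function form (NE7b's body in the size currency, NAMED OPEN).
[cite: Balaban1989LargeFieldII, Thm 1 + (0.1) pp.355–356, (1.79)–(1.80) pp.383–384, (1.89) p.387; Balaban1989LargeFieldI, (0.2) p.176; King1986, (3.10)–(3.11) p.656 (bookkeeping)] -/
theorem relWeightBound_forgiveCompReading₁₃_floorVolume_of_genFun {z M c : ℝ} {n₀ : ℕ} (hz : 1 < z) (hM : 0 ≤ M) (hc : 0 < c) (hthr : M < z ^ n₀)
    (hfloor : ∀ K, n₀ ≤ nR F θ hP g₀ os K) (hlin : ∀ K : ℕ, c * K ≤ (nR F θ hP g₀ os K : ℝ))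
    (hA : ∀ (K : ℕ) (t : ℝ), |t| ≤ 1 →
      ∑ u ∈ classSetK₁₃ θ K₀ g₀ (forgiveCompReading₁₃ K₀ cR F θ hP g₀ os) K,
          z ^ largeFieldVolume (cR F θ hP g₀ os K + 1) u.2 * weightAK₁₃ θ hP K₀ g₀ os (forgiveCompReading₁₃ K₀ cR F θ hP g₀ os) K t u ≤
        M * ∑ u ∈ classSetK₁₃ θ K₀ g₀ (forgiveCompReading₁₃ K₀ cR F θ hP g₀ os) K, weightAK₁₃ θ hP K₀ g₀ os (forgiveCompReading₁₃ K₀ cR F θ hP g₀ os) K t u)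
    (hB : ∀ (K : ℕ) (t : ℝ), |t| ≤ 1 →
      ∑ u ∈ classSetK₁₃ θ K₀ g₀ (forgiveCompReading₁₃ K₀ cR F θ hP g₀ os) K,
          z ^ largeFieldVolume (cR F θ hP g₀ os K + 1) u.2 * weightBK₁₃ θ hP K₀ g₀ os (forgiveCompReading₁₃ K₀ cR F θ hP g₀ os) K t u ≤
        M * ∑ u ∈ classSetK₁₃ θ K₀ g₀ (forgiveCompReading₁₃ K₀ cR F θ hP g₀ os) K, weightBK₁₃ θ hP K₀ g₀ os (forgiveCompReading₁₃ K₀ cR F θ hP g₀ os) K t u) :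
    RelWeightBound
      (crOfRecord₁₃KAt K₀ (forgiveCompReading₁₃ K₀ cR) (fun F θ hP g₀ os _ x => nR F θ hP g₀ os x.1 ≤ largeFieldVolume (cR F θ hP g₀ os x.1 + 1) x.2) sh F θ hP g₀ os).l₀
      (crOfRecord₁₃KAt K₀ (forgiveCompReading₁₃ K₀ cR) (fun F θ hP g₀ os _ x => nR F θ hP g₀ os x.1 ≤ largeFieldVolume (cR F θ hP g₀ os x.1 + 1) x.2) sh F θ hP g₀ os).T
      (crOfRecord₁₃KAt K₀ (forgiveCompReading₁₃ K₀ cR) (fun F θ hP g₀ os _ x => nR F θ hP g₀ os x.1 ≤ largeFieldVolume (cR F θ hP g₀ os x.1 + 1) x.2) sh F θ hP g₀ os).A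
      (crOfRecord₁₃KAt K₀ (forgiveCompReading₁₃ K₀ cR) (fun F θ hP g₀ os _ x => nR F θ hP g₀ os x.1 ≤ largeFieldVolume (cR F θ hP g₀ os x.1 + 1) x.2) sh F θ hP g₀ os).B
      (crOfRecord₁₃KAt K₀ (forgiveCompReading₁₃ K₀ cR) (fun F θ hP g₀ os _ x => nR F θ hP g₀ os x.1 ≤ largeFieldVolume (cR F θ hP g₀ os x.1 + 1) x.2) sh F θ hP g₀ os).Bad
      (crOfRecord₁₃KAt K₀ (forgiveCompReading₁₃ K₀ cR) (fun F θ hP g₀ os _ x => nR F θ hP g₀ os x.1 ≤ largeFieldVolume (cR F θ hP g₀ os x.1 + 1) x.2) sh F θ hP g₀ os).W := by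
  refine relWeightBound_crOfRecord₁₃KAt_thr_of_genFun_linear θ hP K₀ g₀ os (forgiveCompReading₁₃ K₀ cR) _ sh
    (fun K u => largeFieldVolume (cR F θ hP g₀ os K + 1) u.2) (fun K => nR F θ hP g₀ os K) (fun K u hu => ?_) hz hM hc hthr hfloor hlin hA hB
  obtain ⟨K', y⟩ := u
  obtain rfl : K' = K :=
    fst_eq_of_mem_classSetK₁₃ θ K₀ g₀ _ (fun K x hx => forgiveKeyCompSigma_fst_eq θ K₀ g₀ (cR F θ hP g₀ os) K x hx) K hu
  exact Iff.rfl

end FloorVolume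

end Summit.QuantumFields.YangMills.BalabanUVNodes.N20KeyedRelWeightGenFun

end
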